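import Summits.CriticalPhenomena.SAWScalingLimit.Theorems.LeftRightFKG.Negative.PAKitMain
import Summits.CriticalPhenomena.SAWScalingLimit.Theorems.LeftRightFKG.Negative.CornerCertWeight4
import HarnessLib

/-!
# Negative knowledge on crux `LeftRightFKG`, part 20: degenerate chord types; endpoint analysis of the `C₄` family

Crux `stmt-CriticalPhenomena-11232`.  Towards `LeftRightFKG` for `δ = 1`, `C = C₄` and ALL endpoint data
(part 22): the non-computational lemmas.

* `cornerBlock_of_subsingleton` — a chord type with at most one chord satisfies every corner block (`hC` of
  `CornerLoc.pa_inst_of_cornerBlock`) trivially;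
* `subsingleton_domainSAW` — on a box instance at mesh `1`, unless `a ≠ b` and both endpoints are box sites the chord
  type is a subsingleton (closed self-avoiding walks are trivial; a non-trivial walk starts and ends with an edge of
  `Ω_1`);
* `mem_box₄_list`, `toZ2_mem_bsites₄` — a box site lattice-adjacent to the contour `C₄` is one of the twelve
  boundary-adjacent sites (finite check by `decide` over `C₄.support ×` box).

Elementary ("folklore").
-/

namespace Summit.CriticalPhenomena.SAWScalingLimit.Theorems.LeftRightFKG.Negative.PAKit

open Literature.Analysis.ValidatedNumerics
open PolyMP (evalR addR mulR smulR posOn)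
open PolyCert (realOf minorI)
open Census (censusList census)

/-! ## §11a Degenerate chord types and the endpoint analysis of the `C₄` family -/

section Family4Lemmas

open Finset
open Literature.Probability.LatticeModels Literature.Probability.RandomPlanarGeometry
open CornerLoc (cls restrP IsUpOn NextDet PrevDet IsUp IsInst dom μx)
open CornerCert (C₄ inV₄ dAdj₄_iff)
open Census (ofZ2_toZ2 zdAdj_ofZ2_cases)
open scoped Classical

/-- **A chord type with at most one chord satisfies every corner block trivially** (`x ≥ 0` not even needed: with
`s ⊆ {γ}` both sides coincide or the left side vanishes). [folklore] -/
theorem cornerBlock_of_subsingleton {Ω : Set ℂ} {δ : ℝ} {a b : Site 2} [Fintype (SAW.DomainSAW Ω δ a b)]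
    [Subsingleton (SAW.DomainSAW Ω δ a b)] (x : ℝ) :
    ∀ (k : ℕ) (π : ℕ → Site 2) (m : ℕ) (σ : ℕ → Site 2) (Sa Sb : Set (Site 2))
      (A B : Set (SAW.DomainSAW Ω δ a b)) (s : Finset (SAW.DomainSAW Ω δ a b)),
      s = univ.filter (· ∈ restrP k π m σ Sa Sb) → IsUpOn (cls k π m σ) A →
      IsUpOn (cls k π m σ) B → NextDet k A → PrevDet m B →
      (∑ γ ∈ s.filter (· ∈ A), x ^ γ.length) * (∑ γ ∈ s.filter (· ∈ B), x ^ γ.length) ≤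
        (∑ γ ∈ s, x ^ γ.length) * ∑ γ ∈ (s.filter (· ∈ A)).filter (· ∈ B), x ^ γ.length := by
  intro k π m σ Sa Sb A B s _ _ _ _ _
  rcases s.eq_empty_or_nonempty with rfl | ⟨γ, hγ⟩
  · simp
  · have hs : s = {γ} := Finset.eq_singleton_iff_unique_mem.2 ⟨hγ, fun y _ => Subsingleton.elim y γ⟩
    subst hs
    by_cases hA : γ ∈ A <;> by_cases hB : γ ∈ B <;> simp [Finset.filter_singleton, hA, hB]

/-- **Degenerate endpoints give at most one chord** (box instances, mesh `1`): unless `a ≠ b` and both endpoints are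
sites of the box, the chord type of `(Ω, 1, a, b)` is a subsingleton (a closed self-avoiding walk is trivial; a
non-trivial walk starts and ends with an edge of `Ω_1`, whose endpoints are box sites by `hB`). [folklore] -/
theorem subsingleton_domainSAW {Ω : Set ℂ} {inV : ℤ × ℤ → Bool}
    (hB : ∀ x y : Site 2, (discreteDomainGraph Ω 1).Adj x y ↔
      (zdGraph 2).Adj x y ∧ inV (toZ2 x) = true ∧ inV (toZ2 y) = true)
    {a b : Site 2} (h : ¬ (a ≠ b ∧ inV (toZ2 a) = true ∧ inV (toZ2 b) = true)) :
    Subsingleton (SAW.DomainSAW Ω 1 a b) := by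
  have key : ∀ γ : SAW.DomainSAW Ω 1 a b, a = b := by
    intro γ
    by_contra hab
    refine h ⟨hab, ?_, ?_⟩
    · rcases hw : γ.walk with _ | ⟨hadj, _⟩
      · exact absurd rfl hab
      · exact ((hB _ _).1 hadj).2.1
    · rcases hw : γ.walk.reverse with _ | ⟨hadj, _⟩
      · exact absurd rfl hab
      · exact ((hB _ _).1 hadj).2.1
  refine ⟨fun γ₁ γ₂ => ?_⟩
  obtain rfl := key γ₁
  obtain ⟨w₁, p₁⟩ := γ₁
  obtain ⟨w₂, p₂⟩ := γ₂
  obtain rfl := SimpleGraph.Walk.eq_nil_iff_nil.2 (SimpleGraph.Walk.isPath_iff_nil.1 p₁)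
  obtain rfl := SimpleGraph.Walk.eq_nil_iff_nil.2 (SimpleGraph.Walk.isPath_iff_nil.1 p₂)
  rfl

/-- The sites of the `4 × 4` box, listed. [folklore] -/
theorem mem_box₄_list {p : ℤ × ℤ} (h : inV₄ p = true) :
    p ∈ [((0 : ℤ), (0 : ℤ)), (0, 1), (0, 2), (0, 3), (1, 0), (1, 1), (1, 2), (1, 3),
      (2, 0), (2, 1), (2, 2), (2, 3), (3, 0), (3, 1), (3, 2), (3, 3)] := by
  obtain ⟨i, j⟩ := p
  simp only [inV₄, Bool.and_eq_true, decide_eq_true_eq] at h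
  obtain ⟨⟨⟨h1, h2⟩, h3⟩, h4⟩ := h
  interval_cases i <;> interval_cases j <;> decide

/-- **Endpoint analysis of the `C₄` family**: a box site adjacent to the boundary contour `C₄` is one of the twelve
boundary-adjacent sites `{x ∈ {0,3}} ∪ {y ∈ {0,3}}` (a finite check over `C₄.support × box`). [folklore] -/
theorem toZ2_mem_bsites₄ {a a' : Site 2} (hV : inV₄ (toZ2 a) = true) (ha' : a' ∈ C₄.support)
    (hadj : (zdGraph 2).Adj a a') :
    toZ2 a ∈ [((0 : ℤ), (0 : ℤ)), (0, 1), (0, 2), (0, 3), (1, 0), (1, 3),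
      (2, 0), (2, 3), (3, 0), (3, 1), (3, 2), (3, 3)] := by
  have hc := zdAdj_ofZ2_cases (p := toZ2 a) (q := toZ2 a') (by rwa [ofZ2_toZ2, ofZ2_toZ2])
  have D : ∀ q ∈ C₄.support, ∀ p ∈ [((0 : ℤ), (0 : ℤ)), (0, 1), (0, 2), (0, 3), (1, 0), (1, 1), (1, 2), (1, 3),
      (2, 0), (2, 1), (2, 2), (2, 3), (3, 0), (3, 1), (3, 2), (3, 3)],
      (toZ2 q = (p.1 + 1, p.2) ∨ toZ2 q = (p.1 - 1, p.2) ∨ toZ2 q = (p.1, p.2 + 1) ∨ toZ2 q = (p.1, p.2 - 1)) →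
      p ∈ [((0 : ℤ), (0 : ℤ)), (0, 1), (0, 2), (0, 3), (1, 0), (1, 3),
      (2, 0), (2, 3), (3, 0), (3, 1), (3, 2), (3, 3)] := by
    decide
  exact D a' ha' (toZ2 a) (mem_box₄_list hV) hc

end Family4Lemmas

end Summit.CriticalPhenomena.SAWScalingLimit.Theorems.LeftRightFKG.Negative.PAKit
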